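import Mathlib
import Literature.Probability.RandomPlanarGeometry.HexParafermion
import Literature.Probability.RandomPlanarGeometry.HexSAW
import Literature.Probability.LatticeModels.TriangularLatticeProofs
import Literature.Probability.LatticeModels.ThermodynamicLimit

/-!
# Ring counterexample to lattice G2 for crux `HexTight` (stmt-CriticalPhenomena-5423), part 1:
verbatim statements, cells, centres, adjacencies

cdisprove generation 3 (2026-08-16). The refutation `not_latticeG2AsTyped` and the discussion are in
`Negative/LatticeG2False.lean`; this file reproduces VERBATIM the definitions of the line
`Cruxes/HexTight/Lines/tip-renewal-complementarity.lean` (crux work files cannot be imported under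
`Theorems/`) and sets up face coordinates: `U(i,j) = ((i,j), up)`, `D(i,j) = ((i,j), down)`, their
centres, the zigzag adjacencies, and the fact that adjacent centres differ by `≤ 1/2` in real part
and by `1/√3 ≤ 1` in distance.
-/

noncomputable section

open scoped BigOperators
open Classical
open Literature.Probability.LatticeModels
open Literature.Probability.RandomPlanarGeometry.SAW

namespace Summit.CriticalPhenomena.SAWScalingLimit.Cruxes.HexTight.Negative

/-! ## Verbatim copies (`Cruxes/HexTight/Lines/tip-renewal-complementarity.lean`, 2026-08-16) -/

/-- VERBATIM: pinned arc mass `Z_Λ(a → z) = Σ_{γ ⊂ Λ : a → z} x_c^{ℓ(γ)}`. -/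
def arcMass (Λ : Finset HexVertex) (a z : Sym2 HexVertex) : ℝ :=
  ∑ γ : HexMidEdgeSAW Λ a z, hexCriticalFugacity ^ γ.length

/-- VERBATIM: pinned arc mass restricted to an event `E` on the list of visited vertices. -/
def arcMassIf (Λ : Finset HexVertex) (a z : Sym2 HexVertex) (E : List HexVertex → Prop) : ℝ :=
  ∑ γ : HexMidEdgeSAW Λ a z, if E γ.verts then hexCriticalFugacity ^ γ.length else 0

/-- VERBATIM: `u` and `w` are joined by a lattice path all of whose vertices lie in `S`. -/
def LatticeJoined (S : Set HexVertex) (u w : HexVertex) : Prop :=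
  ∃ p : hexGraph.Walk u w, ∀ y ∈ p.support, y ∈ S

/-- VERBATIM: the vertices of `Λ` in the open annulus `A(x; r, R)`. -/
def annVerts (Λ : Finset HexVertex) (x : ℂ) (r R : ℝ) : Set HexVertex :=
  {y | y ∈ Λ ∧ r < dist (hexCenter y) x ∧ dist (hexCenter y) x < R}

/-- VERBATIM: the connected component of `y₀` in the annulus part of `Λ`. -/
def annComp (Λ : Finset HexVertex) (x : ℂ) (r R : ℝ) (y₀ : HexVertex) : Set HexVertex :=
  {y | LatticeJoined (annVerts Λ x r R) y₀ y}

/-- VERBATIM: the list contains a crossing of `D(x; r, R)` whose interior vertices satisfy `P`. -/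
def HasCrossingWith (P : HexVertex → Prop) (x : ℂ) (r R : ℝ) (l : List HexVertex) : Prop :=
  ∃ (l₁ l₂ l₃ : List HexVertex) (u u' w : HexVertex),
    l = l₁ ++ u :: u' :: l₂ ++ w :: l₃ ∧
    ((dist (hexCenter u) x ≤ r ∧ R ≤ dist (hexCenter w) x) ∨
      (R ≤ dist (hexCenter u) x ∧ dist (hexCenter w) x ≤ r)) ∧
    ∀ y ∈ u' :: l₂, P y

/-- VERBATIM: KS's unforced crossing, lattice form. -/
def UnforcedCrossing (Λ : Finset HexVertex) (vt vz : HexVertex) (x : ℂ) (r R : ℝ)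
    (l : List HexVertex) : Prop :=
  ∃ y₀ : HexVertex, y₀ ∈ annVerts Λ x r R ∧
    HasCrossingWith (fun y => y ∈ annComp Λ x r R y₀) x r R l ∧
    LatticeJoined ((↑Λ : Set HexVertex) \ annComp Λ x r R y₀) vt vz

/-- VERBATIM: lattice Condition G2 for pinned critical SAW in the finite domains satisfying `P`. -/
def LatticeG2With (P : Finset HexVertex → Prop) : Prop :=
  ∃ C q : ℝ, ∃ n₁ : ℕ, 1 < C ∧ q < 1 ∧
    ∀ (Λ : Finset HexVertex), P Λ → ∀ (u₀ v₀ u₁ v₁ : HexVertex), u₀ ∉ Λ → v₀ ∈ Λ →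
      hexGraph.Adj u₀ v₀ → u₁ ∉ Λ → v₁ ∈ Λ → hexGraph.Adj u₁ v₁ → s(u₀, v₀) ≠ s(u₁, v₁) →
      ∀ (x : ℂ) (r R : ℝ), (n₁ : ℝ) ≤ r → C * r ≤ R →
        (∃ y : HexVertex, y ∉ Λ ∧ dist (hexCenter y) x ≤ r) →
        arcMassIf Λ s(u₀, v₀) s(u₁, v₁) (UnforcedCrossing Λ v₀ v₁ x r R) ≤
          q * arcMass Λ s(u₀, v₀) s(u₁, v₁)

/-- VERBATIM copy of `TipRenewalComplementarity.LatticeG2` (lattice G2 in ALL finite domains). -/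
def LatticeG2AsTyped : Prop :=
  LatticeG2With fun _ => True

/-! ## Cells and centres -/

/-- up face of the cell `(i, j)` -/
def U (i j : ℤ) : HexVertex := (![i, j], 0)

/-- down face of the cell `(i, j)` -/
def D (i j : ℤ) : HexVertex := (![i, j], 1)

/-- first coordinate of `![a, b]` -/
@[simp] theorem vec2_zero (a b : ℤ) : (![a, b] : Site 2) 0 = a := rfl
/-- second coordinate of `![a, b]` -/
@[simp] theorem vec2_one (a b : ℤ) : (![a, b] : Site 2) 1 = b := rfl

/-- a site is the vector of its two coordinates -/
theorem site_eq (v : Site 2) : v = ![v 0, v 1] := by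
  ext i; fin_cases i <;> rfl

/-- every face is an up face `U` or a down face `D` -/
theorem face_eq (y : HexVertex) : y = U (y.1 0) (y.1 1) ∨ y = D (y.1 0) (y.1 1) := by
  obtain ⟨v, k⟩ := y
  have hv := site_eq v
  fin_cases k
  · left; simp only [U]; rw [← hv]; rfl
  · right; simp only [D]; rw [← hv]; rfl

/-- real part of the centre of `U(i,j)` -/
theorem re_U (i j : ℤ) : (hexCenter (U i j)).re = i + (j : ℝ) / 2 + 1 / 2 := by
  simp [hexCenter, U, triEmbed]; ring

/-- imaginary part of the centre of `U(i,j)` -/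
theorem im_U (i j : ℤ) : (hexCenter (U i j)).im = ((j : ℝ) + 1 / 3) * (Real.sqrt 3 / 2) := by
  simp [hexCenter, U, triEmbed]; ring

/-- real part of the centre of `D(i,j)` -/
theorem re_D (i j : ℤ) : (hexCenter (D i j)).re = i + (j : ℝ) / 2 + 1 := by
  simp [hexCenter, D, triEmbed]; ring

/-- imaginary part of the centre of `D(i,j)` -/
theorem im_D (i j : ℤ) : (hexCenter (D i j)).im = ((j : ℝ) + 2 / 3) * (Real.sqrt 3 / 2) := by
  simp [hexCenter, D, triEmbed]; ring

/-! ### adjacencies of the zigzags -/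

/-- `e₀ = (1, 0)` -/
theorem single0_eq : (Pi.single 0 1 : Site 2) = ![1, 0] := by
  ext i; fin_cases i <;> simp

/-- `e₁ = (0, 1)` -/
theorem single1_eq : (Pi.single 1 1 : Site 2) = ![0, 1] := by
  ext i; fin_cases i <;> simp

/-- coordinatewise subtraction -/
theorem vec_sub (a b c d : ℤ) : (![a, b] : Site 2) - ![c, d] = ![a - c, b - d] := by
  ext i; fin_cases i <;> simp

/-- coordinatewise addition -/
theorem vec_add (a b c d : ℤ) : (![a, b] : Site 2) + ![c, d] = ![a + c, b + d] := by
  ext i; fin_cases i <;> simp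

/-- `U(i,j) ∼ D(i,j)` -/
theorem adj_U_D (i j : ℤ) : hexGraph.Adj (U i j) (D i j) :=
  (hexGraph_adj_iff_of_snd_eq_zero_holds _ _).2 (Or.inl rfl)

/-- `U(i,j) ∼ D(i-1,j)` -/
theorem adj_U_Dl (i j : ℤ) : hexGraph.Adj (U i j) (D (i - 1) j) := by
  refine (hexGraph_adj_iff_of_snd_eq_zero_holds _ _).2 (Or.inr (Or.inl ?_))
  simp only [single0_eq, vec_sub, sub_zero]

/-- `U(i,j) ∼ D(i,j-1)` -/
theorem adj_U_Dd (i j : ℤ) : hexGraph.Adj (U i j) (D i (j - 1)) := by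
  refine (hexGraph_adj_iff_of_snd_eq_zero_holds _ _).2 (Or.inr (Or.inr ?_))
  simp only [single1_eq, vec_sub, sub_zero]

/-- `D(i,j) ∼ U(i+1,j)` -/
theorem adj_D_Ur (i j : ℤ) : hexGraph.Adj (D i j) (U (i + 1) j) := by
  refine (hexGraph_adj_iff_of_snd_eq_one _ _).2 (Or.inr (Or.inl ?_))
  simp only [single0_eq, vec_add, add_zero]

/-- `D(i,j) ∼ U(i,j+1)` -/
theorem adj_D_Uu (i j : ℤ) : hexGraph.Adj (D i j) (U i (j + 1)) := by
  refine (hexGraph_adj_iff_of_snd_eq_one _ _).2 (Or.inr (Or.inr ?_))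
  simp only [single1_eq, vec_add, add_zero]

/-! ### real parts move by at most `1/2` along an edge; edges have length `≤ 1` -/

/-- An up face and an adjacent down face: real parts differ by `≤ 1/2`, squared distance `1/3`. -/
theorem re_sub_re_of_adj_UD {x y : Site 2} (h : hexGraph.Adj (x, 0) (y, 1)) :
    |(hexCenter (x, 0)).re - (hexCenter (y, 1)).re| ≤ 1 / 2 ∧
      Complex.normSq (hexCenter (x, 0) - hexCenter (y, 1)) = 1 / 3 := by
  have hx := site_eq x
  have h3 : Real.sqrt 3 ^ 2 = 3 := Real.sq_sqrt (by norm_num)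
  rcases (hexGraph_adj_iff_of_snd_eq_zero_holds x y).1 h with hy | hy | hy <;> rw [hy]
  · rw [hx]
    refine ⟨?_, ?_⟩
    · rw [show ((![x 0, x 1] : Site 2), (0 : Fin 2)) = U (x 0) (x 1) from rfl,
        show ((![x 0, x 1] : Site 2), (1 : Fin 2)) = D (x 0) (x 1) from rfl, re_U, re_D]
      rw [abs_le]; constructor <;> linarith
    · rw [Complex.normSq_apply, Complex.sub_re, Complex.sub_im,
        show ((![x 0, x 1] : Site 2), (0 : Fin 2)) = U (x 0) (x 1) from rfl,
        show ((![x 0, x 1] : Site 2), (1 : Fin 2)) = D (x 0) (x 1) from rfl, re_U, re_D, im_U, im_D]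
      nlinarith [h3]
  · rw [hx, single0_eq, vec_sub]
    refine ⟨?_, ?_⟩
    · rw [show ((![x 0, x 1] : Site 2), (0 : Fin 2)) = U (x 0) (x 1) from rfl,
        show ((![x 0 - 1, x 1 - 0] : Site 2), (1 : Fin 2)) = D (x 0 - 1) (x 1 - 0) from rfl, re_U, re_D]
      push_cast
      rw [abs_le]; constructor <;> linarith
    · rw [Complex.normSq_apply, Complex.sub_re, Complex.sub_im,
        show ((![x 0, x 1] : Site 2), (0 : Fin 2)) = U (x 0) (x 1) from rfl,
        show ((![x 0 - 1, x 1 - 0] : Site 2), (1 : Fin 2)) = D (x 0 - 1) (x 1 - 0) from rfl, re_U, re_D,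
        im_U, im_D]
      push_cast
      nlinarith [h3]
  · rw [hx, single1_eq, vec_sub]
    refine ⟨?_, ?_⟩
    · rw [show ((![x 0, x 1] : Site 2), (0 : Fin 2)) = U (x 0) (x 1) from rfl,
        show ((![x 0 - 0, x 1 - 1] : Site 2), (1 : Fin 2)) = D (x 0 - 0) (x 1 - 1) from rfl, re_U, re_D]
      push_cast
      rw [abs_le]; constructor <;> linarith
    · rw [Complex.normSq_apply, Complex.sub_re, Complex.sub_im,
        show ((![x 0, x 1] : Site 2), (0 : Fin 2)) = U (x 0) (x 1) from rfl,
        show ((![x 0 - 0, x 1 - 1] : Site 2), (1 : Fin 2)) = D (x 0 - 0) (x 1 - 1) from rfl, re_U, re_D,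
        im_U, im_D]
      push_cast
      nlinarith [h3]

/-- Adjacent faces: real parts differ by at most `1/2`, centres by exactly `1/√3 ≤ 1`. -/
theorem re_sub_re_of_adj {a b : HexVertex} (h : hexGraph.Adj a b) :
    |(hexCenter a).re - (hexCenter b).re| ≤ 1 / 2 ∧ dist (hexCenter a) (hexCenter b) ≤ 1 := by
  have key : ∀ {x y : Site 2}, hexGraph.Adj (x, 0) (y, 1) →
      |(hexCenter (x, 0)).re - (hexCenter (y, 1)).re| ≤ 1 / 2 ∧
        dist (hexCenter (x, 0)) (hexCenter (y, 1)) ≤ 1 := by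
    intro x y hxy
    obtain ⟨h1, h2⟩ := re_sub_re_of_adj_UD hxy
    refine ⟨h1, ?_⟩
    rw [Complex.dist_eq, ← sq_le_one_iff₀ (norm_nonneg _), Complex.sq_norm, h2]
    norm_num
  obtain ⟨x, k⟩ := a
  obtain ⟨y, l⟩ := b
  fin_cases k <;> fin_cases l
  · exact absurd h (not_hexGraph_adj_of_snd_eq_holds _ _ rfl)
  · exact key h
  · obtain ⟨h1, h2⟩ := key h.symm
    exact ⟨by rw [abs_sub_comm]; exact h1, by rw [dist_comm]; exact h2⟩
  · exact absurd h (not_hexGraph_adj_of_snd_eq_holds _ _ rfl)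

/-- `U` is injective -/
theorem U_inj {i j i' j' : ℤ} (h : U i j = U i' j') : i = i' ∧ j = j' :=
  ⟨by simpa [U] using congrArg (fun y : HexVertex => y.1 0) h,
   by simpa [U] using congrArg (fun y : HexVertex => y.1 1) h⟩

/-- up faces are not down faces -/
theorem U_ne_D (i j i' j' : ℤ) : U i j ≠ D i' j' := by
  intro h
  have := congrArg Prod.snd h
  simp [U, D] at this

/-! ### offsets from the centre `x = c(U(0,0))` and distances -/

/-- the centre of the annuli: `c(U(0,0)) = (1/2, √3/6)` -/
def x₀ : ℂ := hexCenter (U 0 0)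

/-- `Re x = 1/2` -/
theorem x₀_re : x₀.re = 1 / 2 := by rw [x₀, re_U]; push_cast; ring

/-- `Im x = √3/6` -/
theorem x₀_im : x₀.im = 1 / 3 * (Real.sqrt 3 / 2) := by rw [x₀, im_U]; push_cast; ring

/-- `1 ≤ √3` -/
theorem one_le_sqrt3 : (1 : ℝ) ≤ Real.sqrt 3 := by
  rw [show (1 : ℝ) = Real.sqrt 1 from Real.sqrt_one.symm]
  exact Real.sqrt_le_sqrt (by norm_num)

/-- the real offset is at most the distance -/
theorem abs_re_le_dist (z : ℂ) : |z.re - x₀.re| ≤ dist z x₀ := by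
  rw [Complex.dist_eq, ← Complex.sub_re]; exact Complex.abs_re_le_norm _

/-- the imaginary offset is at most the distance -/
theorem abs_im_le_dist (z : ℂ) : |z.im - x₀.im| ≤ dist z x₀ := by
  rw [Complex.dist_eq, ← Complex.sub_im]; exact Complex.abs_im_le_norm _


end Summit.CriticalPhenomena.SAWScalingLimit.Cruxes.HexTight.Negative

end
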